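import Literature.AlgebraicGeometry.Resolution.PermissibleBlowup
import Literature.AlgebraicGeometry.Resolution.StrictNormalCrossingsAt
import Literature.AlgebraicGeometry.Resolution.RsopMonomialIdeals
import HarnessLib

/-!
# The ideal of a regular centre at a point is generated by part of a regular system of parameters

Topic: `Literature/AlgebraicGeometry/Resolution`. [CoP1] = Cossart–Piltant, J. Algebra 320
(2008), proof of Prop. 4.2, p. 8: "let `Y = V(y_1, …, y_r)` be permissible for `E` at `x` (so
`r = 2` or `r = 3`)", with `(y_1, …, y_r)` part of a regular system of parameters
`(u_1, u_2, u_3)` of `𝒪_{X,x}` — the standard local description of a regular closed subscheme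
`Y` of a regular scheme `X` (Matsumura, Thm. 14.2: `R/P` regular iff `P` is generated by part of
a regular system of parameters, and then `dim R/P + r = dim R`). PROVED, packaging
`exists_span_eq_of_isRegularLocalRing_quotient` (`RegularQuotientIdeal.lean`) and
`exists_extend_to_rsop` (`StrictNormalCrossingsDescent.lean`) into the `IsRsopPart` language of
the chart computations (`NearPointsTau.lean`, `BlowupChartRsop.lean`):

* `exists_isRsopPart_span_range_eq` — for a regular local ring `R` and `P ⊆ 𝔪` with `R/P`
  regular: `P = (c_1, …, c_r)` with `c` part of a regular system of parameters;
* `exists_isRsopPart_fin_span_range_eq` — with `r` prescribed by `dim R/P + r = dim R`;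
* `exists_isRsopPart_span_range_eq_stalkIdeal`, `…_of_mem_closeds` (and `Fin r` versions) —
  **for a regular closed subscheme `Y` of a locally Noetherian scheme through a point `x` with
  `𝒪_{X,x}` regular, `𝓘_{Y,x} = (c_1, …, c_r)` with `c` part of a regular system of parameters
  of `𝒪_{X,x}`.**

## Sources

* V. Cossart, O. Piltant, J. Algebra 320 (2008) 1051–1082, proof of Prop. 4.2, p. 8.
  [CossartPiltant2008]
* H. Matsumura, Commutative Ring Theory (1986), Thm. 14.2. [Matsumura1987]
-/

noncomputable section

open CategoryTheory AlgebraicGeometry TopologicalSpace IsLocalRing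

namespace Literature.AlgebraicGeometry.Resolution

universe u

open Scheme.IdealSheafData

/-! ## Local rings -/

section LocalRing

variable {R : Type u} [CommRing R] [IsRegularLocalRing R]

/-- **Matsumura 14.2 in `IsRsopPart` form**: an ideal `P ⊆ 𝔪` of a regular local ring with
regular quotient `R/P` is generated by part of a regular system of parameters.
[cite: Matsumura1987, Thm. 14.2] -/
theorem exists_isRsopPart_span_range_eq {P : Ideal R} (hP : P ≤ maximalIdeal R)
    [IsRegularLocalRing (R ⧸ P)] :
    ∃ (r : ℕ) (c : Fin r → R), IsRsopPart c ∧ Ideal.span (Set.range c) = P := by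
  obtain ⟨r, f, hfG, hspan, hli⟩ :=
    exists_span_eq_of_isRegularLocalRing_quotient hP (P : Set R) (Ideal.span_eq P)
  have hf : ∀ i, f i ∈ maximalIdeal R := fun i => hP (hfG i)
  have hind := (linearIndependent_toCotangent_iff_forall_mem f hf).mp hli
  obtain ⟨e, y, hdim, hspan'⟩ := exists_extend_to_rsop f hf hind
  exact ⟨r, f, ⟨inferInstance, e, y, hdim, hspan'⟩, hspan⟩

/-- The same with the number of generators prescribed by the dimension formula
`dim R/P + r = dim R` (the number of members of a part of a regular system of parameters
generating `P` is determined by it, `IsRsopPart.ringKrullDim_quotient_add`).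
[cite: Matsumura1987, Thm. 14.2] -/
theorem exists_isRsopPart_fin_span_range_eq {P : Ideal R} (hP : P ≤ maximalIdeal R)
    [IsRegularLocalRing (R ⧸ P)] {r : ℕ} (hdim : ringKrullDim (R ⧸ P) + r = ringKrullDim R) :
    ∃ c : Fin r → R, IsRsopPart c ∧ Ideal.span (Set.range c) = P := by
  obtain ⟨m, c, hc, hcP⟩ := exists_isRsopPart_span_range_eq hP
  have hm := hc.ringKrullDim_quotient_add
  rw [hcP] at hm
  obtain ⟨k, hk⟩ := exists_nat_cast_eq_ringKrullDim (R := R ⧸ P)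
  obtain ⟨d, hd⟩ := exists_nat_cast_eq_ringKrullDim (R := R)
  rw [hk, hd] at hm hdim
  have h1 : ((k + m : ℕ) : WithBot ℕ∞) = d := by push_cast; exact hm
  have h2 : ((k + r : ℕ) : WithBot ℕ∞) = d := by push_cast; exact hdim
  have h3 : k + m = k + r := by exact_mod_cast h1.trans h2.symm
  obtain rfl : m = r := by omega
  exact ⟨c, hc, hcP⟩

end LocalRing

/-! ## Regular centres in schemes -/

section Scheme

variable {X : Scheme.{u}} [IsLocallyNoetherian X]

/-- **The stalk of the ideal of a regular closed subscheme at a point with regular local ring is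
generated by part of a regular system of parameters** ([CoP1]: "`Y = V(y_1, …, y_r)`").
[cite: CossartPiltant2008, proof of Prop. 4.2] -/
theorem exists_isRsopPart_span_range_eq_stalkIdeal {C : X.IdealSheafData}
    (hC : Scheme.IsRegular C.subscheme) {x : X} [IsRegularLocalRing (X.presheaf.stalk x)]
    (hx : x ∈ C.support) :
    ∃ (r : ℕ) (c : Fin r → X.presheaf.stalk x), IsRsopPart c ∧
      Ideal.span (Set.range c) = stalkIdeal C x := by
  haveI := isRegularLocalRing_stalk_quotient_stalkIdeal hC hx
  exact exists_isRsopPart_span_range_eq ((mem_support_iff_stalkIdeal_le C x).mp hx)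

/-- The same with `r` prescribed by `dim 𝒪_{Y,x} + r = dim 𝒪_{X,x}` (`r = 2` for a curve through
a closed point of a threefold, `r = 3` for the closed point itself, in [CoP1]).
[cite: CossartPiltant2008, proof of Prop. 4.2] -/
theorem exists_isRsopPart_fin_span_range_eq_stalkIdeal {C : X.IdealSheafData}
    (hC : Scheme.IsRegular C.subscheme) {x : X} [IsRegularLocalRing (X.presheaf.stalk x)]
    (hx : x ∈ C.support) {r : ℕ}
    (hdim : ringKrullDim (X.presheaf.stalk x ⧸ stalkIdeal C x) + r =
      ringKrullDim (X.presheaf.stalk x)) :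
    ∃ c : Fin r → X.presheaf.stalk x, IsRsopPart c ∧ Ideal.span (Set.range c) = stalkIdeal C x := by
  haveI := isRegularLocalRing_stalk_quotient_stalkIdeal hC hx
  exact exists_isRsopPart_fin_span_range_eq ((mem_support_iff_stalkIdeal_le C x).mp hx) hdim

/-- For a regular closed subset `Y` (with its reduced structure `vanishingIdeal Y`) through `x`.
[cite: CossartPiltant2008, proof of Prop. 4.2] -/
theorem exists_isRsopPart_span_range_eq_stalkIdeal_of_mem_closeds {Y : Closeds X}
    (hreg : Scheme.IsRegular (vanishingIdeal Y).subscheme) {x : X}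
    [IsRegularLocalRing (X.presheaf.stalk x)] (hx : x ∈ (Y : Set X)) :
    ∃ (r : ℕ) (c : Fin r → X.presheaf.stalk x), IsRsopPart c ∧
      Ideal.span (Set.range c) = stalkIdeal (vanishingIdeal Y) x := by
  refine exists_isRsopPart_span_range_eq_stalkIdeal hreg ?_
  rw [← SetLike.mem_coe, coe_support_vanishingIdeal]
  exact hx

/-- And with `r` prescribed by the dimension formula. [cite: CossartPiltant2008, proof of Prop. 4.2] -/
theorem exists_isRsopPart_fin_span_range_eq_stalkIdeal_of_mem_closeds {Y : Closeds X}
    (hreg : Scheme.IsRegular (vanishingIdeal Y).subscheme) {x : X}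
    [IsRegularLocalRing (X.presheaf.stalk x)] (hx : x ∈ (Y : Set X)) {r : ℕ}
    (hdim : ringKrullDim (X.presheaf.stalk x ⧸ stalkIdeal (vanishingIdeal Y) x) + r =
      ringKrullDim (X.presheaf.stalk x)) :
    ∃ c : Fin r → X.presheaf.stalk x, IsRsopPart c ∧
      Ideal.span (Set.range c) = stalkIdeal (vanishingIdeal Y) x := by
  refine exists_isRsopPart_fin_span_range_eq_stalkIdeal hreg ?_ hdim
  rw [← SetLike.mem_coe, coe_support_vanishingIdeal]
  exact hx

end Scheme

end Literature.AlgebraicGeometry.Resolution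

end
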